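import Summits.HodgeConjecture.HodgeConjecture.Theorems.MarkmanPartnerTransportPicardThreeK3SquaresKugaSatakeSelfTranspose
import Literature.AlgebraicGeometry.HodgeTheory.MotivatedClasses
import Literature.AlgebraicGeometry.Hyperkaehler.K3HilbertTypeLefschetzStandard

/-!
# Route MarkmanPartnerTransport · crux `LowPicardRealMultiplication` (stmt-HodgeConjecture-19653) —
# programme «KS-SELF-X», step 2: the Lefschetz–transpose of an algebraic correspondence INTO A FOURFOLD,
# returned to `H²` by André's Lefschetz involution (Charles–Markman's `B(X)`), and the Hodge–Riemann
# non-vanishing `(Λ ∘ ᵗO ∘ L^{m-2} ∘ O) σ ≠ 0`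

The `K3^{[2]}`-side twin of gen 14's `…KugaSatakeSelfTranspose` (`exists_lefschetzTranspose`, surfaces). Let
`X` be a smooth projective FOURFOLD satisfying Grothendieck's standard conjecture `B(X)` (for `K3^{[2]}`-type:
Charles–Markman 2013, the tree's record `CharlesMarkman2013_lefschetzStandard_K3HilbertType`, BY NAME), `Y` smooth
projective of dimension `m ≥ 2` (the square `A × A` of a Kuga–Satake variety) and
`O₁, O₂ : H²(X(ℂ); ℂ) → H²(Y(ℂ); ℂ)` maps INDUCED BY ALGEBRAIC CYCLES on `Y × X`. For a surface the Poincaré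
transpose `ᵗO₁` of `O₁` lands back in `H²`; for the fourfold it lands in `H⁶(X(ℂ); ℂ)`
(`Ring2.AbelianAll.IsAlgebraicCorrespondence.exists_transpose` with `2·3 + 2·1 = 2·4`), and we return to `H²` by
the Lefschetz involution `Λ = *_L : H⁶ → H²` of a rational Kähler class of `X` (`HodgeTheory.lefschetzInvolution`),
which is ALGEBRAIC by `B(X)` (`StandardConjectureBStar`) and BIJECTIVE by hard Lefschetz
(`lefschetzInvolution_bijective`, a tree theorem for Kähler–rational data):

* `exists_lefschetzTransposeHK` — there is ONE `ℂ`-linear `R : H²(Y(ℂ); ℂ) → H²(X(ℂ); ℂ)` (namely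
  `Λ ∘ ᵗO₁ ∘ L_η^{m-2}`) with `R ∘ O₁`, `R ∘ O₂` ALGEBRAIC self-correspondences of `X` (degree `0` on `H²`), and
  `(R ∘ O₁) σ ≠ 0` for every `σ ∈ H²(X(ℂ); ℂ)` whose image `O₁ σ` is a non-zero `(2,0)`-class with
  `O₁ σ̄ = \overline{O₁ σ}`: Hodge–Riemann on `Y` (gen 14's `cupPairing_conj_lefschetzPow_ne_zero`:
  `⟨\overline{O₁σ}, L^{m-2} O₁σ⟩_Y ≠ 0`), the adjunction `⟨O₁ x, w⟩_Y = ⟨ᵗO₁ w, x⟩_X`, and injectivity of `Λ`.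
* `exists_lefschetzTransposeHK_of_charlesMarkman` — the same for a smooth projective `K3^{[2]}`-type fourfold,
  `B(X)` supplied by the Charles–Markman record.

This is Varesco's Lemma 4.4 / Thm. 4.5 step "compose with the inverse of the Lefschetz isomorphism, algebraic by
[Charles–Markman]" (Math. Z. 2023 §4, Rem. 4.3 and Cor. 4.6: "`X` satisfying `B(X)` in degree two").
THEOREMS ONLY; CONDITIONAL only through the displayed hypotheses (`B(X)` resp. the Charles–Markman record); no
sorry, no new definition or named fact. Prover seat hodge-nonav-19652-p1 (gen 15), `--supports stmt-HodgeConjecture-19653`.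

References: M. Varesco, Math. Z. 305 (2023) Lemma 4.4, Thm. 4.5, Cor. 4.6; F. Charles, E. Markman, Compos. Math.
149 (2013) Thm. 1.1; Y. André, Publ. IHÉS 83 (1996) §1.1; C. Voisin, *Hodge Theory I* Thm. 6.25, Thm. 6.32;
W. Fulton, *Intersection Theory* §16.1.
-/

set_option linter.dupNamespace false

noncomputable section

namespace Summit.HodgeConjecture.HodgeConjecture.Theorems.MarkmanPartnerTransport.KugaSatakeHK

open CategoryTheory Literature.AlgebraicGeometry Literature.AlgebraicGeometry.Motives
open Literature.AlgebraicGeometry.HodgeTheory Literature.AlgebraicTopology.SingularHomology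
open Literature.AlgebraicGeometry.Hyperkaehler
open Literature.Geometry.Kaehler (lefschetzPow)
open Summit.HodgeConjecture.HodgeConjecture.Ring2.AbelianAll
open Summit.HodgeConjecture.HodgeConjecture.Theorems.MarkmanPartnerTransport.KugaSatakeSelf

variable {X Y : SchemeOver ℂ} {m : ℕ}

/-- **THE LEFSCHETZ–TRANSPOSE CORRESPONDENCES INTO A FOURFOLD WITH `B(X)`.** Let `X` be a smooth projective
fourfold with `B(X)` (`StandardConjectureBStar 4 X η` for every `η`), `Y` smooth projective of dimension
`m ≥ 2`, and `O₁, O₂ : H²(X(ℂ); ℂ) → H²(Y(ℂ); ℂ)` induced by algebraic cycles. Then there is ONE `ℂ`-linear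
`R : H²(Y(ℂ); ℂ) → H²(X(ℂ); ℂ)` (namely `*_L ∘ ᵗO₁ ∘ L_η^{m-2}` for rational Kähler classes of `Y` and `X`) such
that `R ∘ O₁` and `R ∘ O₂` are ALGEBRAIC self-correspondences of `X`, and `(R ∘ O₁) σ ≠ 0` for every `σ` whose
image `O₁ σ` is a non-zero `(2,0)`-class with `O₁ σ̄ = \overline{O₁ σ}` (Hodge–Riemann on `Y`, the adjunction
`⟨O₁ x, w⟩_Y = ⟨ᵗO₁ w, x⟩_X`, and injectivity of `*_L : H⁶ → H²` by hard Lefschetz).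
[cite: Varesco2023, Lemma 4.4, Thm. 4.5 and Cor. 4.6] [cite: Andre1996Motifs, §1.1 (p. 10)]
[cite: VoisinHodgeI2002, §6.3.2 Thm. 6.32] [cite: Fulton1998, §16.1] -/
theorem exists_lefschetzTransposeHK (hX : IsSmoothProjective 4 X)
    (hB : ∀ η : complexBetti X 2, StandardConjectureBStar 4 X η) (hY : IsSmoothProjective m Y) (hm : 2 ≤ m)
    {O₁ O₂ : complexBetti X (2 * 1) →ₗ[ℂ] complexBetti Y 2}
    (hO₁ : IsAlgebraicCorrespondence m 4 Y X O₁) (hO₂ : IsAlgebraicCorrespondence m 4 Y X O₂) :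
    ∃ R : complexBetti Y 2 →ₗ[ℂ] complexBetti X (2 * 1),
      IsAlgebraicCorrespondence 4 4 X X (R ∘ₗ O₁) ∧ IsAlgebraicCorrespondence 4 4 X X (R ∘ₗ O₂) ∧
      ∀ σ : complexBetti X (2 * 1), IsOfHodgeType m Y 2 2 0 (O₁ σ) → O₁ σ ≠ 0 →
        O₁ (conjClass _ (2 * 1) σ) = conjClass _ 2 (O₁ σ) → (R ∘ₗ O₁) σ ≠ 0 := by
  obtain ⟨r, hr⟩ : ∃ r, 2 + r = m := ⟨m - 2, by omega⟩
  obtain ⟨D⟩ := nonempty_kaehlerRationalDatum hY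
  obtain ⟨DX⟩ := nonempty_kaehlerRationalDatum hX
  -- the rational Kähler classes are algebraic (Lefschetz `(1,1)`); `η_X` is a polarisation class
  have hη : D.Hη ∈ algebraicClasses Y 1 :=
    lefschetzOneOne_rational_holds hY _ D.isRationalClass_Hη D.isOfHodgeType_Hη
  have hpol : IsPolarizationClass 4 X DX.Hη :=
    ⟨DX.isRationalClass_Hη, lefschetzOneOne_rational_holds hX _ DX.isRationalClass_Hη DX.isOfHodgeType_Hη,
      DX.hasHardLefschetzProperty hX⟩
  -- the transpose of `O₁` lands in `H⁶(X)`
  have ha : 2 * 3 + 2 * 1 = 2 * 4 := rfl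
  have hb : 2 + (2 + 2 * r) = 2 * m := by omega
  obtain ⟨Tt, hTt, hadj⟩ := IsAlgebraicCorrespondence.exists_transpose hY hX ha hb hO₁
  -- `Λ = *_L : H⁶(X) → H²(X)`, algebraic by `B(X)`, bijective by hard Lefschetz
  have hΛ : IsAlgebraicCorrespondence 4 4 X X (lefschetzInvolution hpol.hasHardLefschetz ha) :=
    hB DX.Hη hpol (2 * 3) (2 * 1) ha
  have hΛbij := lefschetzInvolution_bijective hpol.hasHardLefschetz ha
  -- `R := Λ ∘ ᵗO₁ ∘ L^r`
  have hR₀ : IsAlgebraicCorrespondence 4 m X Y (Tt ∘ₗ lefschetzPow D.Hη r 2) :=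
    IsAlgebraicCorrespondence.comp_lefschetzPow hX hY hη 2 r hTt
  have hR : IsAlgebraicCorrespondence 4 m X Y
      (lefschetzInvolution hpol.hasHardLefschetz ha ∘ₗ (Tt ∘ₗ lefschetzPow D.Hη r 2)) :=
    IsAlgebraicCorrespondence.comp hX hX hY hR₀ hΛ (by omega)
  refine ⟨lefschetzInvolution hpol.hasHardLefschetz ha ∘ₗ (Tt ∘ₗ lefschetzPow D.Hη r 2),
    IsAlgebraicCorrespondence.comp hX hY hX hO₁ hR (by omega),
    IsAlgebraicCorrespondence.comp hX hY hX hO₂ hR (by omega), fun σ hσ hσ0 hconj h0 => ?_⟩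
  have hHR := cupPairing_conj_lefschetzPow_ne_zero hY D hr hb hσ hσ0
  apply hHR
  have key := hadj (conjClass _ (2 * 1) σ) (lefschetzPow D.Hη r 2 (O₁ σ))
  have heven : ((-1 : ℂ) ^ (2 * 1 * (2 + 2 * r))) = 1 := Even.neg_one_pow ⟨2 + 2 * r, by ring⟩
  rw [hconj, heven, one_mul] at key
  rw [key]
  -- `Λ (ᵗO₁ (L^r (O₁ σ))) = 0` forces `ᵗO₁ (L^r (O₁ σ)) = 0`
  have h0' : Tt (lefschetzPow D.Hη r 2 (O₁ σ)) = 0 := by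
    have h0'' : lefschetzInvolution hpol.hasHardLefschetz ha (Tt (lefschetzPow D.Hη r 2 (O₁ σ))) = 0 := by
      simpa only [LinearMap.comp_apply] using h0
    exact hΛbij.1 (by rw [h0'', map_zero])
  rw [h0', map_zero, LinearMap.zero_apply]

/-- **The Lefschetz–transpose correspondences into a smooth projective `K3^{[2]}`-type fourfold**, `B(X)`
supplied by Charles–Markman (`CharlesMarkman2013_lefschetzStandard_K3HilbertType.of_squareType`, BY NAME).
CONDITIONAL on that record. [cite: Varesco2023, Thm. 4.5 and Cor. 4.6] [cite: CharlesMarkman2013, Thm. 1.1 (§1)] -/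
theorem exists_lefschetzTransposeHK_of_charlesMarkman (hCM : CharlesMarkman2013_lefschetzStandard_K3HilbertType)
    (hX : IsSmoothProjective 4 X) (hK : IsOfK3HilbertSquareType X) (hY : IsSmoothProjective m Y) (hm : 2 ≤ m)
    {O₁ O₂ : complexBetti X (2 * 1) →ₗ[ℂ] complexBetti Y 2}
    (hO₁ : IsAlgebraicCorrespondence m 4 Y X O₁) (hO₂ : IsAlgebraicCorrespondence m 4 Y X O₂) :
    ∃ R : complexBetti Y 2 →ₗ[ℂ] complexBetti X (2 * 1),
      IsAlgebraicCorrespondence 4 4 X X (R ∘ₗ O₁) ∧ IsAlgebraicCorrespondence 4 4 X X (R ∘ₗ O₂) ∧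
      ∀ σ : complexBetti X (2 * 1), IsOfHodgeType m Y 2 2 0 (O₁ σ) → O₁ σ ≠ 0 →
        O₁ (conjClass _ (2 * 1) σ) = conjClass _ 2 (O₁ σ) → (R ∘ₗ O₁) σ ≠ 0 :=
  exists_lefschetzTransposeHK hX
    (fun η => CharlesMarkman2013_lefschetzStandard_K3HilbertType.of_squareType hCM hX hK η) hY hm hO₁ hO₂

end Summit.HodgeConjecture.HodgeConjecture.Theorems.MarkmanPartnerTransport.KugaSatakeHK

end
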